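import Mathlib
import HarnessLib
import Literature.Analysis.FluidPDE.ConstantinFeffermanEnstrophySlab
import Summits.NavierStokesRegularity.NavierStokesRegularity.Theorems.LocalIrrotationalScarDoorTargetTheorem

/-!
# STAGED door S15 `LocalIrrotationalScarDoor` — LEVEL 2 «any window»: an analytic final-time trace that is irrotational
# on ANY open piece of the punctured ball already forbids Type-I blow-up at `x₀`

p1 ROUND-14's `Sketch` lists «AnyWindow» (an arbitrary nonempty open window `U ⊂ B(x₀,ρ) ∖ {x₀}` instead of a whole
half-ball side) as the natural strengthening of the door, reachable once the final-time trace is real analytic on the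
punctured ball (the route's auxiliary `TopTimeLocalAnalyticity`).  Given that analyticity as a HYPOTHESIS,
`localIrrotationalScarDoor_anyWindow` upgrades the landed door `localIrrotationalScarDoor_target`:

* pick `z ≠ x₀` in the window and the direction `e = (z − x₀)/‖z − x₀‖`; the half-ball side
  `S = B(x₀,ρ) ∩ {⟪x − x₀, e⟫ > 0}` is open, CONVEX (hence preconnected), contains `z`, and misses `x₀`;
* `curl u(T,·) = curlCLM ∘ ∇u(T,·)` is analytic on `S`, vanishes near `z`, hence on all of `S` (identity theorem);
* the door applies on the side `S` (`C¹` there from analyticity).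

`curl_window_dense_of_backwardSingular` is the contrapositive «scar» reading: at a space–time Type-I point with an
analytic final-time trace, `curl u(T,·)` vanishes on NO neighbourhood of any point of the punctured ball.
Seat nsreg-p6 g7 (anchor `--supports stmt-NavierStokesRegularity-11719`).
WHAT THIS IS NOT: not NS regularity (Clay A) — conditional on local space–time Type I AND on analyticity of the
final-time trace; not a route open.
-/

noncomputable section

open MeasureTheory Set Function Filter Topology TopologicalSpace Metric
open Literature.Analysis Literature.Analysis.FluidPDE
open Summit.NavierStokesRegularity.NavierStokesRegularity.Theorems.LocalIrrotationalScarDoorTargetTheorem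
open scoped RealInnerProductSpace

-- the summit and its single sub-problem share the name (CONVENTIONS §1), as in every Theorems file
set_option linter.dupNamespace false

namespace Summit.NavierStokesRegularity.NavierStokesRegularity.Theorems.LocalIrrotationalScarDoorAnyWindow

/-- The open half-space `{x | 0 < ⟪x − x₀, e⟫}` is convex. -/
theorem convex_halfSide (x₀ e : EuclideanSpace ℝ (Fin 3)) :
    Convex ℝ {x : EuclideanSpace ℝ (Fin 3) | 0 < inner ℝ (x - x₀) e} := by
  intro x hx y hy a b ha hb hab
  simp only [mem_setOf_eq] at hx hy ⊢
  have hx₀ : x₀ = a • x₀ + b • x₀ := by rw [← add_smul, hab, one_smul]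
  have hdecomp : a • x + b • y - x₀ = a • (x - x₀) + b • (y - x₀) := by
    calc a • x + b • y - x₀ = a • x + b • y - (a • x₀ + b • x₀) := by rw [← hx₀]
      _ = a • (x - x₀) + b • (y - x₀) := by simp only [smul_sub]; abel
  rw [hdecomp, inner_add_left, real_inner_smul_left, real_inner_smul_left]
  rcases ha.eq_or_lt with rfl | ha'
  · rw [zero_add] at hab
    rw [hab, zero_mul, one_mul, zero_add]; exact hy
  · nlinarith [mul_pos ha' hx, mul_nonneg hb hy.le]

/-- **S15, LEVEL 2 («any window»).**  Local space–time Type I at `(x₀,T)`, a pointwise final-time velocity trace on the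
punctured ball `B(x₀,ρ) ∖ {x₀}` which is REAL ANALYTIC there, and `curl u(T,·) = 0` near ONE point of the punctured ball
⇒ backward bounded at `x₀`. -/
theorem localIrrotationalScarDoor_anyWindow :
    ∀ (ν T : ℝ), 0 < ν → 0 < T → ∀ (u : ℝ → EuclideanSpace ℝ (Fin 3) → EuclideanSpace ℝ (Fin 3))
      (p : ℝ → EuclideanSpace ℝ (Fin 3) → ℝ),
    Literature.Analysis.FluidPDE.IsClassicalNSSolutionOn (Set.Ico 0 T) ν 0 u p →
    Literature.Analysis.FluidPDE.IsLerayHopfOn T ν 0 (u 0) u →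
    Literature.Analysis.FluidPDE.HasRapidSpatialDecay (u 0) →
    ∀ (x₀ : EuclideanSpace ℝ (Fin 3)) (ρ M : ℝ), 0 < ρ →
    (∀ t ∈ Set.Ico 0 T, T - ρ ^ 2 < t → ∀ x ∈ Metric.ball x₀ ρ,
      ‖u t x‖ * (‖x - x₀‖ + Real.sqrt (ν * (T - t))) ≤ M) →
    (∀ x ∈ Metric.ball x₀ ρ, x ≠ x₀ →
      Filter.Tendsto (fun t => u t x) (nhdsWithin T (Set.Iio T)) (nhds (u T x))) →
    AnalyticOnNhd ℝ (u T) (Metric.ball x₀ ρ \ {x₀}) →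
    (∃ z ∈ Metric.ball x₀ ρ, z ≠ x₀ ∧ Literature.Analysis.FluidPDE.curl (u T) =ᶠ[nhds z] 0) →
    Literature.Analysis.FluidPDE.IsBackwardBoundedAt u T x₀ := by
  intro ν T hν hT u p hcl hLH hdec x₀ ρ M hρ hI htr hA ⟨z, hz, hzx, hcz⟩
  -- the direction through `z`
  have hnz : 0 < ‖z - x₀‖ := norm_pos_iff.2 (sub_ne_zero.2 hzx)
  set e : EuclideanSpace ℝ (Fin 3) := ‖z - x₀‖⁻¹ • (z - x₀) with he_def
  have he : ‖e‖ = 1 := by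
    rw [he_def, norm_smul, norm_inv, norm_norm, inv_mul_cancel₀ hnz.ne']
  -- the half-ball side through `z`
  set S : Set (EuclideanSpace ℝ (Fin 3)) := Metric.ball x₀ ρ ∩ {x | 0 < inner ℝ (x - x₀) e} with hS
  have hSW : S ⊆ Metric.ball x₀ ρ \ {x₀} := by
    rintro x ⟨hx, hxe⟩
    refine ⟨hx, fun hx0 => ?_⟩
    rw [mem_singleton_iff] at hx0
    simp only [mem_setOf_eq, hx0, sub_self, inner_zero_left, lt_self_iff_false] at hxe
  have hzS : z ∈ S := by
    refine ⟨hz, ?_⟩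
    simp only [mem_setOf_eq, he_def, real_inner_smul_right, real_inner_self_eq_norm_sq]
    have : ‖z - x₀‖⁻¹ * ‖z - x₀‖ ^ 2 = ‖z - x₀‖ := by field_simp
    rw [this]; exact hnz
  have hSpre : IsPreconnected S := ((convex_ball x₀ ρ).inter (convex_halfSide x₀ e)).isPreconnected
  -- `curl u(T)` is analytic on `S` and vanishes near `z`, hence on `S`
  have hAS : AnalyticOnNhd ℝ (u T) S := hA.mono hSW
  have hcurlA : AnalyticOnNhd ℝ (Literature.Analysis.FluidPDE.curl (u T)) S := by
    rw [curl_eq_curlCLM_comp_fderiv']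
    exact curlCLM.comp_analyticOnNhd hAS.fderiv
  have hcurlS : EqOn (Literature.Analysis.FluidPDE.curl (u T)) 0 S :=
    hcurlA.eqOn_zero_of_preconnected_of_eventuallyEq_zero hSpre hzS hcz
  -- feed the door on the side `S`
  have hC1 : ContDiffOn ℝ 1 (u T) (Metric.ball x₀ ρ ∩ {x | 0 < inner ℝ (x - x₀) e}) :=
    hAS.contDiffOn_of_completeSpace
  refine localIrrotationalScarDoor_target ν T hν hT u p hcl hLH hdec x₀ e ρ M he hρ hI
    (fun x hx hxe => htr x hx (hSW ⟨hx, hxe⟩).2) hC1 fun x hx hxe => ?_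
  have := hcurlS ⟨hx, hxe⟩
  simpa using this

/-- **Scar reading (contrapositive).**  At a local space–time Type-I point `(x₀,T)` which IS backward singular, an
analytic final-time trace on the punctured ball has `curl u(T,·)` vanishing near NO point of the punctured ball: the
irrotational set has empty interior there. -/
theorem curl_not_eventuallyEq_zero_of_backwardSingular {ν T : ℝ} (hν : 0 < ν) (hT : 0 < T)
    {u : ℝ → EuclideanSpace ℝ (Fin 3) → EuclideanSpace ℝ (Fin 3)} {p : ℝ → EuclideanSpace ℝ (Fin 3) → ℝ}
    (hcl : Literature.Analysis.FluidPDE.IsClassicalNSSolutionOn (Set.Ico 0 T) ν 0 u p)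
    (hLH : Literature.Analysis.FluidPDE.IsLerayHopfOn T ν 0 (u 0) u)
    (hdec : Literature.Analysis.FluidPDE.HasRapidSpatialDecay (u 0))
    {x₀ : EuclideanSpace ℝ (Fin 3)} {ρ M : ℝ} (hρ : 0 < ρ)
    (hI : ∀ t ∈ Set.Ico 0 T, T - ρ ^ 2 < t → ∀ x ∈ Metric.ball x₀ ρ,
      ‖u t x‖ * (‖x - x₀‖ + Real.sqrt (ν * (T - t))) ≤ M)
    (htr : ∀ x ∈ Metric.ball x₀ ρ, x ≠ x₀ →
      Filter.Tendsto (fun t => u t x) (nhdsWithin T (Set.Iio T)) (nhds (u T x)))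
    (hA : AnalyticOnNhd ℝ (u T) (Metric.ball x₀ ρ \ {x₀}))
    (hsing : ¬ Literature.Analysis.FluidPDE.IsBackwardBoundedAt u T x₀) :
    ∀ z ∈ Metric.ball x₀ ρ, z ≠ x₀ → ¬ (Literature.Analysis.FluidPDE.curl (u T) =ᶠ[nhds z] 0) :=
  fun z hz hzx hcz => hsing (localIrrotationalScarDoor_anyWindow ν T hν hT u p hcl hLH hdec x₀ ρ M hρ hI htr hA
    ⟨z, hz, hzx, hcz⟩)

end Summit.NavierStokesRegularity.NavierStokesRegularity.Theorems.LocalIrrotationalScarDoorAnyWindow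

end
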